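import Mathlib
import Literature.Computability.AlgebraicComplexity.Apolarity
import Literature.Computability.AlgebraicComplexity.ApolarityAction
import Literature.Computability.AlgebraicComplexity.LinSubst
import Summits.ValiantsHypothesis.ValiantsHypothesis.Theorems.BorderApolarityFixedWitnessObstructionQPAnnSubmodule

/-!
# Border apolarity, crux `ToricWitnessObstructionQP` (stmt-ValiantsHypothesis-14753),
# line `Sketch`, reshape 4: helper stub `snf_noPureOwn_of_finrank_lt`

Route `ValiantsHypothesis/BorderApolarity`, crux item `stmt-ValiantsHypothesis-14753`,
line `Sketch`, reshape 4 (structure of stable normal forms), wave-4 helper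
`snf_noPureOwn_of_finrank_lt` (no pure-own elements below the unused dimension).

The residual of the line records that the operator spaces `J` (degree-`k` forms) attached to a
stable normal form are stable under the transvections `X u ↦ X u + c • X z` for every OWN
variable `u` (`ess u`) and every UNUSED variable `z` (`¬ ess z`).  This file proves: if moreover
`dim J < C(#unused + k - 1, k)`, then `J` contains no nonzero PURE-OWN form (a form none of whose
monomials involves an unused variable).

Proof (shadow feeding, then a count).
* By the polarisation lemma `snf_X_mul_pderiv_mem` of the sibling file
  `BorderApolarityToricWitnessObstructionQPPolarisation.lean` (re-checked here under private
  `snfnp_pol_` names, so that this file does not depend on that one), `J` is stable under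
  `g ↦ X z * ∂_u g` (`u` own, `z` unused).  Iterating along the exponents (induction on the
  degree, `snfnp_feed`): for `e` pure-own and `d` pure-unused of the same degree and `f ∈ J`,
  `x^d · (∂^e ⌟ f) ∈ J`, because `∂_u` kills the unused monomial `x^{d'}` already produced.
* For `f` homogeneous of degree `k` and `e ∈ supp f`, `∂^e ⌟ f = (∏ eᵢ!) · f_e` is a nonzero
  constant (`snfnp_apolarAction_monomial_self`), so every pure-unused monomial `x^d` of degree
  `k` lies in `J` as soon as `J` has a nonzero pure-own element (`snfnp_monomial_mem`).
* The pure-unused forms of degree `k` contain the (injective) `rename Subtype.val`-image of the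
  degree-`k` forms in the unused variables, of dimension `C(#unused + k - 1, k)`
  (`finrank_homogeneousSubmodule_eq_choose_card`), whence `C(#unused + k - 1, k) ≤ dim J`
  (`snfnp_choose_le_finrank`), contradicting the hypothesis.
-/

open MvPolynomial Filter
open scoped BigOperators Matrix
open Literature.Computability.AlgebraicComplexity

set_option linter.dupNamespace false

namespace Summit.ValiantsHypothesis.ValiantsHypothesis.Theorems.BorderApolarityToricWitnessObstructionQP

open Summit.ValiantsHypothesis.ValiantsHypothesis.Theorems.BorderApolarityFixedWitnessObstructionQP

section Polarisation

/-! ### Private copy of the polarisation lemma (`snf_X_mul_pderiv_mem`) -/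

variable {σ : Type} [Fintype σ] [DecidableEq σ]

/-- The transvection `1 + c • E_{z u}` acts on variables by
`X i ↦ X i + [i = u] • c • X z`. [folklore] -/
private theorem snfnp_pol_transvection_X (u z : σ) (c : ℂ) (i : σ) :
    linSubst σ ℂ (1 + c • Matrix.single z u (1 : ℂ)) (X i) =
      X i + if i = u then c • X z else 0 := by
  rw [linSubst_X]
  simp only [Matrix.add_apply, Matrix.one_apply, Matrix.smul_apply, Matrix.single_apply,
    smul_eq_mul, mul_ite, mul_one, mul_zero, add_smul, Finset.sum_add_distrib, ite_smul,
    one_smul, zero_smul, Finset.sum_ite_eq', Finset.mem_univ, if_true, ite_and,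
    Finset.sum_ite_eq]
  congr 1
  by_cases h : i = u
  · simp [h]
  · simp [h, Ne.symm h]

/-- The generating polynomial `P_f(t) := f(X_u + t X_z)` evaluates at `t = c` to the transvection
`T_c f`. [folklore] -/
private theorem snfnp_pol_eval_genPoly (u z : σ) (c : ℂ) (f : MvPolynomial σ ℂ) :
    (aeval (fun i : σ => Polynomial.C (X i : MvPolynomial σ ℂ) +
        if i = u then Polynomial.X * Polynomial.C (X z : MvPolynomial σ ℂ) else 0) f).eval
        (C c) = linSubst σ ℂ (1 + c • Matrix.single z u (1 : ℂ)) f := by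
  induction f using MvPolynomial.induction_on with
  | C a =>
    rw [linSubst_C, aeval_C, Polynomial.algebraMap_apply, Polynomial.eval_C, algebraMap_eq]
  | add p q hp hq => rw [map_add, Polynomial.eval_add, hp, hq, map_add]
  | mul_X p i hp =>
    rw [map_mul, Polynomial.eval_mul, hp, map_mul, aeval_X, snfnp_pol_transvection_X]
    split_ifs
    · rw [Polynomial.eval_add, Polynomial.eval_C, Polynomial.eval_mul, Polynomial.eval_X,
        Polynomial.eval_C, smul_eq_C_mul]
    · rw [add_zero, add_zero, Polynomial.eval_C]

/-- The constant coefficient of the generating polynomial `P_f` is `f`. [folklore] -/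
private theorem snfnp_pol_coeff_zero_genPoly (u z : σ) (f : MvPolynomial σ ℂ) :
    (aeval (fun i : σ => Polynomial.C (X i : MvPolynomial σ ℂ) +
        if i = u then Polynomial.X * Polynomial.C (X z : MvPolynomial σ ℂ) else 0) f).coeff 0 =
      f := by
  rw [Polynomial.coeff_zero_eq_eval_zero, ← C_0, snfnp_pol_eval_genPoly, zero_smul, add_zero,
    linSubst_one, AlgHom.id_apply]

/-- The coefficient of `t` in the generating polynomial `P_f` is the polarisation `X z * ∂_u f`.
[folklore] -/
private theorem snfnp_pol_coeff_one_genPoly (u z : σ) (f : MvPolynomial σ ℂ) :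
    (aeval (fun i : σ => Polynomial.C (X i : MvPolynomial σ ℂ) +
        if i = u then Polynomial.X * Polynomial.C (X z : MvPolynomial σ ℂ) else 0) f).coeff 1 =
      X z * pderiv u f := by
  induction f using MvPolynomial.induction_on with
  | C a =>
    rw [aeval_C, Polynomial.algebraMap_apply, Polynomial.coeff_C, if_neg one_ne_zero, pderiv_C,
      mul_zero]
  | add p q hp hq => rw [map_add, Polynomial.coeff_add, hp, hq, map_add, mul_add]
  | mul_X p i hp =>
    have h0 := snfnp_pol_coeff_zero_genPoly u z p
    rw [map_mul, aeval_X, pderiv_mul]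
    split_ifs with hi
    · subst hi
      rw [mul_add, Polynomial.coeff_add, Polynomial.coeff_mul_C, hp, ← mul_assoc,
        Polynomial.coeff_mul_C, Polynomial.coeff_mul_X, h0, pderiv_X_self]
      ring
    · rw [add_zero, Polynomial.coeff_mul_C, hp, pderiv_X_of_ne hi]
      ring

/-- **Transvection expansion**: `T_c f = ∑_{j ≤ R} c ^ j • F j` for all `c`, with
`F 1 = X z * ∂_u f` and `F j = 0` for `j > R`. [folklore] -/
private theorem snfnp_pol_transvection_expansion (u z : σ) (f : MvPolynomial σ ℂ) :
    ∃ (R : ℕ) (F : ℕ → MvPolynomial σ ℂ), F 1 = X z * pderiv u f ∧ (∀ j, R < j → F j = 0) ∧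
      ∀ c : ℂ, linSubst σ ℂ (1 + c • Matrix.single z u (1 : ℂ)) f =
        ∑ j ∈ Finset.range (R + 1), c ^ j • F j := by
  set P : Polynomial (MvPolynomial σ ℂ) :=
    aeval (fun i : σ => Polynomial.C (X i : MvPolynomial σ ℂ) +
      if i = u then Polynomial.X * Polynomial.C (X z : MvPolynomial σ ℂ) else 0) f
  refine ⟨P.natDegree, fun j => P.coeff j, snfnp_pol_coeff_one_genPoly u z f,
    fun j hj => Polynomial.coeff_eq_zero_of_natDegree_lt hj, ?_⟩
  intro c
  rw [← snfnp_pol_eval_genPoly u z c f, Polynomial.eval_eq_sum_range]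
  refine Finset.sum_congr rfl fun j _ => ?_
  rw [← C_pow, mul_comm, C_mul']

omit [Fintype σ] [DecidableEq σ] in
/-- **Vandermonde extraction**: if the values of `c ↦ ∑_{j ≤ R} c ^ j • F j` lie in a subspace
`J` for all scalars `c`, then so does every coefficient `F j`, `j ≤ R`. [folklore] -/
private theorem snfnp_pol_vandermonde_mem (J : Submodule ℂ (MvPolynomial σ ℂ)) (R : ℕ)
    (F : ℕ → MvPolynomial σ ℂ)
    (h : ∀ c : ℂ, (∑ j ∈ Finset.range (R + 1), c ^ j • F j) ∈ J) :
    ∀ j ∈ Finset.range (R + 1), F j ∈ J := by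
  intro j hj
  -- nodes `0, 1, …, R` and the Vandermonde matrix `M i l = i ^ l`
  set v : Fin (R + 1) → ℂ := fun i => ((i : ℕ) : ℂ)
  set M : Matrix (Fin (R + 1)) (Fin (R + 1)) ℂ := Matrix.vandermonde v with hM
  have hdet : IsUnit M.det := by
    rw [isUnit_iff_ne_zero, hM, Matrix.det_vandermonde_ne_zero_iff]
    intro a b hab
    exact Fin.ext (Nat.cast_injective (R := ℂ) hab)
  have hval : ∀ i : Fin (R + 1), (∑ l : Fin (R + 1), M i l • F l) ∈ J := by
    intro i
    have := h (v i)
    rw [Finset.sum_range (fun l => v i ^ l • F l)] at this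
    simpa [hM, Matrix.vandermonde_apply] using this
  -- invert: `F j = ∑ i, M⁻¹ j i • (∑ l, M i l • F l)`, a combination of members of `J`
  have hcalc : (∑ i : Fin (R + 1), M⁻¹ ⟨j, Finset.mem_range.mp hj⟩ i •
      ∑ l : Fin (R + 1), M i l • F l) = F j := by
    simp_rw [Finset.smul_sum, smul_smul]
    rw [Finset.sum_comm]
    simp_rw [← Finset.sum_smul, ← Matrix.mul_apply, Matrix.nonsing_inv_mul _ hdet,
      Matrix.one_apply, ite_smul, one_smul, zero_smul, Finset.sum_ite_eq, Finset.mem_univ,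
      if_true]
  rw [← hcalc]
  exact Submodule.sum_mem _ fun i _ => Submodule.smul_mem _ _ (hval i)

/-- **Polarisation preserves transvection-stable subspaces** (private copy of
`snf_X_mul_pderiv_mem`): a `ℂ`-subspace of polynomials stable under all transvections
`X u ↦ X u + c • X z` is stable under `f ↦ X z * ∂_u f`. [folklore] -/
private theorem snfnp_pol_X_mul_pderiv_mem (J : Submodule ℂ (MvPolynomial σ ℂ)) (u z : σ)
    (hJ : ∀ c : ℂ, ∀ f ∈ J, linSubst σ ℂ (1 + c • Matrix.single z u (1 : ℂ)) f ∈ J) :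
    ∀ f ∈ J, X z * pderiv u f ∈ J := by
  intro f hf
  obtain ⟨R, F, hF1, hFR, hT⟩ := snfnp_pol_transvection_expansion u z f
  have hsum : ∀ c : ℂ, (∑ j ∈ Finset.range (R + 1), c ^ j • F j) ∈ J := fun c =>
    hT c ▸ hJ c f hf
  rw [← hF1]
  by_cases hR : 1 < R + 1
  · exact snfnp_pol_vandermonde_mem J R F hsum 1 (Finset.mem_range.mpr hR)
  · rw [hFR 1 (by omega)]
    exact Submodule.zero_mem J

end Polarisation

section ShadowFeeding

variable {σ : Type}

/-- **Iterated polarisation (shadow feeding along exponents).**  If `J` is stable under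
`g ↦ X z * ∂_u g` for all own `u` and unused `z`, then for `e` pure-own and `d` pure-unused of
the same degree and every `f ∈ J`, `x^d · (∂^e ⌟ f) ∈ J`. [folklore] -/
theorem snfnp_feed (ess : σ → Prop) (J : Submodule ℂ (MvPolynomial σ ℂ))
    (hP : ∀ u z : σ, ess u → ¬ ess z → ∀ g ∈ J, X z * pderiv u g ∈ J) :
    ∀ (n : ℕ) (e d : σ →₀ ℕ), e.degree = n → d.degree = n → (∀ i, ¬ ess i → e i = 0) →
      (∀ i, ess i → d i = 0) → ∀ f ∈ J,
        monomial d (1 : ℂ) * apolarAction (monomial e (1 : ℂ)) f ∈ J := by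
  intro n
  induction n with
  | zero =>
    intro e d he hd _ _ f hf
    rw [Finsupp.degree_eq_zero_iff] at he hd
    subst he
    subst hd
    rw [← C_apply, apolarAction_C, one_smul, C_1, one_mul]
    exact hf
  | succ n ih =>
    intro e d he hd hep hdp f hf
    -- an own variable `u` dividing `x^e` and an unused variable `z` dividing `x^d`
    have hne : e ≠ 0 := by
      rintro rfl
      rw [map_zero] at he
      omega
    have hnd : d ≠ 0 := by
      rintro rfl
      rw [map_zero] at hd
      omega
    obtain ⟨u, hu⟩ := Finsupp.support_nonempty_iff.2 hne
    obtain ⟨z, hz⟩ := Finsupp.support_nonempty_iff.2 hnd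
    rw [Finsupp.mem_support_iff] at hu hz
    have hu' : ess u := by
      by_contra h
      exact hu (hep u h)
    have hz' : ¬ ess z := fun h => hz (hdp z h)
    obtain ⟨e', rfl⟩ : ∃ e', e = Finsupp.single u 1 + e' :=
      ⟨e - Finsupp.single u 1, (add_tsub_cancel_of_le
        (Finsupp.single_le_iff.2 (Nat.one_le_iff_ne_zero.2 hu))).symm⟩
    obtain ⟨d', rfl⟩ : ∃ d', d = Finsupp.single z 1 + d' :=
      ⟨d - Finsupp.single z 1, (add_tsub_cancel_of_le
        (Finsupp.single_le_iff.2 (Nat.one_le_iff_ne_zero.2 hz))).symm⟩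
    rw [map_add, Finsupp.degree_single] at he hd
    have he'p : ∀ i, ¬ ess i → e' i = 0 := fun i hi => by
      have := hep i hi
      rw [Finsupp.add_apply] at this
      omega
    have hd'p : ∀ i, ess i → d' i = 0 := fun i hi => by
      have := hdp i hi
      rw [Finsupp.add_apply] at this
      omega
    -- the induction hypothesis, then one more polarisation `P_{z,u}`
    have ih' := ih e' d' (by omega) (by omega) he'p hd'p f hf
    have hmem := hP u z hu' hz' _ ih'
    rw [pderiv_mul, pderiv_monomial, hd'p u hu', Nat.cast_zero, mul_zero, monomial_zero,
      zero_mul, zero_add, ← mul_assoc] at hmem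
    rw [monomial_single_add, monomial_single_add, pow_one, pow_one, apolarAction_X_mul,
      apolarAction_X]
    exact hmem

/-- **The top self-contraction is a nonzero constant**: for `f` homogeneous of degree `k` and
`e ∈ supp f`, `∂^e ⌟ f = C (f_e · ∏ᵢ eᵢ!)` (all other monomials of `f` have the same degree as
`x^e` and are not multiples of it). [folklore] -/
theorem snfnp_apolarAction_monomial_self [DecidableEq σ] {f : MvPolynomial σ ℂ} {k : ℕ}
    (hf : f.IsHomogeneous k) {e : σ →₀ ℕ} (he : e ∈ f.support) :
    apolarAction (monomial e (1 : ℂ)) f =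
      C (coeff e f * ∏ i ∈ e.support, ((e i).descFactorial (e i) : ℂ)) := by
  have hdeg : ∀ d ∈ f.support, d.degree = k := fun d hd => by
    rw [Finsupp.degree_eq_weight_one]
    exact hf (mem_support_iff.1 hd)
  conv_lhs => rw [as_sum f]
  rw [apolarAction_sum_right, Finset.sum_eq_single e]
  · rw [apolarAction_monomial_monomial, one_mul, tsub_self, ← C_apply]
  · intro d hd hne
    apply apolarAction_monomial_monomial_of_not_le
    intro hle
    apply hne
    have h1 := add_tsub_cancel_of_le hle
    have h2 : (d - e).degree = 0 := by
      have h3 : (e + (d - e)).degree = d.degree := by rw [h1]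
      rw [map_add, hdeg d hd, hdeg e he] at h3
      omega
    rw [Finsupp.degree_eq_zero_iff] at h2
    rw [h2, add_zero] at h1
    exact h1.symm
  · intro h
    exact absurd he h

/-- **Shadow feeding**: in a polarisation-stable space `J`, a homogeneous pure-own element of
degree `k` with a support exponent `e` forces every pure-unused monomial of degree `k` into `J`
(`x^d · (∂^e ⌟ f)` is a nonzero scalar multiple of `x^d`). [folklore] -/
theorem snfnp_monomial_mem [DecidableEq σ] (ess : σ → Prop) (J : Submodule ℂ (MvPolynomial σ ℂ))
    (k : ℕ) (hP : ∀ u z : σ, ess u → ¬ ess z → ∀ g ∈ J, X z * pderiv u g ∈ J)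
    {f : MvPolynomial σ ℂ} (hf : f ∈ J) (hhom : f.IsHomogeneous k)
    (hpure : ∀ d ∈ f.support, ∀ i, ¬ ess i → d i = 0) {e : σ →₀ ℕ} (he : e ∈ f.support)
    (d : σ →₀ ℕ) (hd : d.degree = k) (hdp : ∀ i, ess i → d i = 0) :
    monomial d (1 : ℂ) ∈ J := by
  have hedeg : e.degree = k := by
    rw [Finsupp.degree_eq_weight_one]
    exact hhom (mem_support_iff.1 he)
  have hmem := snfnp_feed ess J hP k e d hedeg hd (hpure e he) hdp f hf
  rw [snfnp_apolarAction_monomial_self hhom he, mul_comm, C_mul'] at hmem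
  have ha : coeff e f * ∏ i ∈ e.support, ((e i).descFactorial (e i) : ℂ) ≠ 0 := by
    refine mul_ne_zero (mem_support_iff.1 he) (Finset.prod_ne_zero_iff.2 fun i _ => ?_)
    rw [Nat.descFactorial_self]
    exact_mod_cast Nat.factorial_ne_zero (e i)
  have h2 := J.smul_mem (coeff e f * ∏ i ∈ e.support, ((e i).descFactorial (e i) : ℂ))⁻¹ hmem
  rwa [smul_smul, inv_mul_cancel₀ ha, one_smul] at h2

end ShadowFeeding

section Count

variable {σ : Type} [Fintype σ]

/-- **Counting the pure-unused monomials**: if a subspace `J` of the degree-`k` forms contains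
every pure-unused monomial of degree `k`, then `C(#unused + k - 1, k) ≤ dim J` — the pure-unused
forms contain the injective `rename`-image of the degree-`k` forms in the unused variables, of
dimension `C(#unused + k - 1, k)` (stars and bars). [folklore] -/
theorem snfnp_choose_le_finrank (ess : σ → Prop) [DecidablePred ess]
    (J : Submodule ℂ (MvPolynomial σ ℂ)) (k : ℕ) (hJk : J ≤ homogeneousSubmodule σ ℂ k)
    (hall : ∀ d : σ →₀ ℕ, d.degree = k → (∀ i, ess i → d i = 0) → monomial d (1 : ℂ) ∈ J) :
    Nat.choose (Fintype.card {i : σ // ¬ ess i} + k - 1) k ≤ Module.finrank ℂ J := by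
  haveI : Module.Finite ℂ (homogeneousSubmodule σ ℂ k) :=
    Module.Finite.iff_fg.2 (homogeneousSubmodule_fg σ ℂ k)
  haveI : Module.Finite ℂ J := Submodule.finiteDimensional_of_le hJk
  set φ : MvPolynomial {i : σ // ¬ ess i} ℂ →ₗ[ℂ] MvPolynomial σ ℂ :=
    (rename (Subtype.val : {i : σ // ¬ ess i} → σ)).toLinearMap with hφ
  have hinj : Function.Injective φ := rename_injective _ Subtype.val_injective
  have hle : (homogeneousSubmodule {i : σ // ¬ ess i} ℂ k).map φ ≤ J := by
    rw [Submodule.map_le_iff_le_comap]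
    intro g hg
    refine (Submodule.span_le.2 ?_)
      (Literature.Barriers.ValiantsHypothesis.mem_span_monomial_of_isHomogeneous
        ((mem_homogeneousSubmodule k g).1 hg))
    rintro _ ⟨β, hβ, rfl⟩
    simp only [SetLike.mem_coe, Submodule.mem_comap, hφ, AlgHom.toLinearMap_apply,
      rename_monomial]
    refine hall _ (by rw [Finsupp.degree_mapDomain]; exact hβ) fun i hi => ?_
    exact Finsupp.mapDomain_notin_range _ _ (by rintro ⟨x, rfl⟩; exact x.2 hi)
  calc Nat.choose (Fintype.card {i : σ // ¬ ess i} + k - 1) k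
      = Module.finrank ℂ (homogeneousSubmodule {i : σ // ¬ ess i} ℂ k) :=
        (finrank_homogeneousSubmodule_eq_choose_card k).symm
    _ = Module.finrank ℂ ((homogeneousSubmodule {i : σ // ¬ ess i} ℂ k).map φ) :=
        (Submodule.equivMapOfInjective φ hinj _).finrank_eq
    _ ≤ Module.finrank ℂ J := Submodule.finrank_mono hle

end Count

/-- **No pure-own elements below the unused dimension** (wave-4 helper `W4b`): if a
transvection-stable space `J` of degree-`k` forms has dimension `< C(#unused + k - 1, k)`, it
contains no nonzero pure-own element — shadow feeding would put all `C(#unused + k - 1, k)`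
linearly independent pure-unused monomials of degree `k` into `J`. [folklore] -/
theorem snf_noPureOwn_of_finrank_lt : ∀ {σ : Type} [Fintype σ] [DecidableEq σ] (ess : σ → Prop)
    [DecidablePred ess] (J : Submodule ℂ (MvPolynomial σ ℂ)) (k : ℕ),
    J ≤ MvPolynomial.homogeneousSubmodule σ ℂ k →
    (∀ u z : σ, ess u → ¬ ess z → ∀ c : ℂ, ∀ f ∈ J,
      linSubst σ ℂ (1 + c • Matrix.single z u (1 : ℂ)) f ∈ J) →
    Module.finrank ℂ J < Nat.choose (Fintype.card {i : σ // ¬ ess i} + k - 1) k →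
    ∀ f ∈ J, (∀ d ∈ f.support, ∀ i, ¬ ess i → d i = 0) → f = 0 := by
  intro σ _ _ ess _ J k hJk hJ hdim f hf hpure
  by_contra hf0
  -- `J` is stable under the polarisations `g ↦ X z * ∂_u g` (`u` own, `z` unused)
  have hP : ∀ u z : σ, ess u → ¬ ess z → ∀ g ∈ J, X z * pderiv u g ∈ J :=
    fun u z hu hz => snfnp_pol_X_mul_pderiv_mem J u z (hJ u z hu hz)
  obtain ⟨e, he⟩ := ne_zero_iff.1 hf0
  have hhom : f.IsHomogeneous k := (mem_homogeneousSubmodule k f).1 (hJk hf)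
  -- shadow feeding: every pure-unused monomial of degree `k` lies in `J`
  have hall : ∀ d : σ →₀ ℕ, d.degree = k → (∀ i, ess i → d i = 0) → monomial d (1 : ℂ) ∈ J :=
    fun d hd hdp => snfnp_monomial_mem ess J k hP hf hhom hpure (mem_support_iff.2 he) d hd hdp
  -- the count
  exact absurd hdim (not_lt.2 (snfnp_choose_le_finrank ess J k hJk hall))

end Summit.ValiantsHypothesis.ValiantsHypothesis.Theorems.BorderApolarityToricWitnessObstructionQP
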